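import Literature.AlgebraicGeometry.Motives.CurveGenusBaseChange
import Literature.AlgebraicGeometry.Motives.CurveManyPoints
import Literature.NumberTheory.DiophantineGeometry.FunctionFieldNonspecialDivisors
import HarnessLib

/-!
# The general locus `{t ∈ Cᵍ : h⁰(Σ tᵢ) = 1}` is non-empty over a finite Galois extension
# (Milne, *Jacobian Varieties*, §4 Prop. 4.2 (a), §5 Lemma 5.2 (b))

For a smooth proper geometrically integral curve `C / K` of genus `g` there is a finite Galois
extension `L / K` such that `C` has an `L`-valued point and the (open, `isOpen_generalLocus`)
general locus of the `L`-curve `C_L` is non-empty: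
**`exists_galois_nonempty_generalLocus`**. Milne works over `k_s` ("Lemma 5.2 (b): there is an open
subset `U` of `Cʳ` such that `h⁰(Σ Pᵢ) = 1` for all `(P₁, …, P_r)` in `U`"); here in the finite
form needed for Galois descent. Ingredients, all proved in the tree:

* sections of a scheme over a field are determined by their image point (`FieldPoint.section_ext`,
  through Mathlib `Scheme.SpecToEquivOfField`: the residue map `κ(x) → L` of a section is forced,
  `descResidueField_eq_of_section`), and have residue degree one
  (`residueDegree_eq_one_of_section`); hence distinct rational points of `C_L` give distinct
  rational PLACES of its function field (`ratPtPoint_id_injective`, `degree_place_ratPtPoint`);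
* `nonempty_generalLocus_of_sections` — `N ≥ 2g − 1` distinct rational points of an `L`-curve `X`
  make `generalLocus X g` non-empty: Milne's Lemma 5.2 (b) in function-field form
  (`exists_ell_sum_single_eq_one`, `NumberTheory/DiophantineGeometry/FunctionFieldNonspecialDivisors`)
  picks `g` of them with `ℓ(Σ Pᵢ) = 1`, and the tuple is general
  (`imagePtPow_tuplePt_mem_generalLocus`, `Motives/CurveGeneralDivisorsAtPoints`); the genus of the
  auxiliary copy `X ×_L Spec L` is `g` (`curveGenus_curveBC_id`, `Motives/CurveGenusBaseChange`);
* the supply of points: `2g + 1` distinct `L`-valued points over one finite Galois `L`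
  (`exists_galois_algPoints_injective`, `Motives/CurveManyPoints`), turned into sections of `C_L`
  (`sectionOfAlgPoint`), with `g(C_L) = g(C)` (`curveGenus_curveBC`).

Everything is proved; no named facts (D-0026). Step (γ2) of the construction of the Jacobian
(`nonempty_jacobian_of_isSmoothProjective`): the chart `W ⊆ C_L^{(g)}` of Milne §4 is non-empty.

## References

* J. S. Milne, *Jacobian Varieties*, in: Arithmetic Geometry (Cornell–Silverman, eds.), Springer
  1986, §4 Prop. 4.2 (a), §5 Lemma 5.2 (pp. 248–251 of the volume). [Milne1986JacobianVarieties]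
-/

noncomputable section

open CategoryTheory CategoryTheory.Limits AlgebraicGeometry IsLocalRing Order TopologicalSpace
  MonoidalCategory CartesianMonoidalCategory

universe u

namespace Literature.AlgebraicGeometry.Motives

open Literature.AlgebraicGeometry.RelativeSpec

/-! ### Sections of a scheme over a field are determined by their image point -/

namespace FieldPoint

variable {L : Type u} [Field L] {X : Scheme.{u}} (p : X ⟶ Spec (.of L))

/-- For a section `Spec L → Spec κ(x) → X` of `p : X → Spec L` given by `φ : κ(x) → L`, the ring
map `ψ : L → κ(pt) → κ(x)` induced by `p` is a right inverse of `φ`: `ψ (φ y) = y`. [folklore] -/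
theorem residueFieldMap_preimage_apply (x : X) (φ : X.residueField x ⟶ .of L)
    (h : Spec.map φ ≫ X.fromSpecResidueField x ≫ p = 𝟙 _) (y : X.residueField x) :
    (p.residueFieldMap x).hom
      ((Spec.preimage ((Spec (.of L)).fromSpecResidueField (p x))).hom (φ.hom y)) = y := by
  set ι := p.residueFieldMap x
  set ε' := Spec.preimage ((Spec (.of L)).fromSpecResidueField (p x))
  have hε : Spec.map ε' = (Spec (.of L)).fromSpecResidueField (p x) := Spec.map_preimage _
  -- `ε' ≫ ι ≫ φ = 𝟙`
  have key : ε' ≫ ι ≫ φ = 𝟙 _ := by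
    apply Spec.map_injective
    rw [Spec.map_comp, Spec.map_comp, Spec.map_id, hε, Category.assoc,
      Scheme.Hom.SpecMap_residueFieldMap_fromSpecResidueField]
    exact h
  have e : ∀ a, φ.hom (ι.hom (ε'.hom a)) = a := fun a ↦ by
    have := congrArg (fun ψ : CommRingCat.of L ⟶ CommRingCat.of L ↦ ψ.hom a) key
    simpa using this
  apply φ.hom.injective
  rw [e]

/-- The residue map `φ : κ(x) → L` of a section through `x` is unique. [folklore] -/
theorem descResidueField_eq_of_section (x : X) (φ₁ φ₂ : X.residueField x ⟶ .of L)
    (h₁ : Spec.map φ₁ ≫ X.fromSpecResidueField x ≫ p = 𝟙 _)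
    (h₂ : Spec.map φ₂ ≫ X.fromSpecResidueField x ≫ p = 𝟙 _) : φ₁ = φ₂ := by
  ext y
  have hy := residueFieldMap_preimage_apply p x φ₂ h₂ y
  conv_lhs => rw [← hy]
  have h1 := residueFieldMap_preimage_apply p x φ₁ h₁
  -- `φ₁ (ψ b) = b` for all `b`: apply with `y := ψ b`… use injectivity of `ψ ∘ φ₁` instead
  set ψ : L → X.residueField x := fun b ↦ (p.residueFieldMap x).hom
    ((Spec.preimage ((Spec (.of L)).fromSpecResidueField (p x))).hom b)
  change φ₁.hom (ψ (φ₂.hom y)) = φ₂.hom y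
  have hψ : Function.Injective ψ := fun a b hab ↦ by
    simpa using congrArg (fun z ↦ z) (((p.residueFieldMap x).hom.comp
      (Spec.preimage ((Spec (.of L)).fromSpecResidueField (p x))).hom).injective hab)
  apply hψ
  exact h1 (ψ (φ₂.hom y))

/-- **Sections of `X → Spec L` are determined by their image point.** [folklore] -/
theorem section_ext {f₁ f₂ : Spec (.of L) ⟶ X} (h₁ : f₁ ≫ p = 𝟙 _) (h₂ : f₂ ≫ p = 𝟙 _)
    (heq : f₁ (closedPoint L) = f₂ (closedPoint L)) : f₁ = f₂ := by
  apply (X.SpecToEquivOfField L).injective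
  rw [Scheme.SpecToEquivOfField_eq_iff]
  refine ⟨heq, ?_⟩
  change X.descResidueField (Scheme.stalkClosedPointTo f₁) =
    (X.residueFieldCongr heq).hom ≫ X.descResidueField (Scheme.stalkClosedPointTo f₂)
  apply descResidueField_eq_of_section p (f₁ (closedPoint L))
  · rw [← Category.assoc, Scheme.descResidueField_stalkClosedPointTo_fromSpecResidueField]
    exact h₁
  · rw [Spec.map_comp, Category.assoc, ← Category.assoc (Spec.map (X.residueFieldCongr heq).hom),
      Scheme.residueFieldCongr_fromSpecResidueField, ← Category.assoc,
      Scheme.descResidueField_stalkClosedPointTo_fromSpecResidueField]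
    exact h₂

/-- **A section has residue degree one**: `[κ(x) : L] = 1` at the image of a section. [folklore] -/
theorem residueDegree_eq_one_of_section {f : Spec (.of L) ⟶ X} (hf : f ≫ p = 𝟙 _) :
    p.residueDegree (f (closedPoint L)) = 1 := by
  set x := f (closedPoint L)
  have hφ : Spec.map (X.descResidueField (Scheme.stalkClosedPointTo f)) ≫
      X.fromSpecResidueField x ≫ p = 𝟙 _ := by
    rw [← Category.assoc, Scheme.descResidueField_stalkClosedPointTo_fromSpecResidueField]
    exact hf
  have hsurj : Function.Surjective (p.residueFieldMap x).hom := fun y ↦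
    ⟨_, residueFieldMap_preimage_apply p x _ hφ y⟩
  letI := (p.residueFieldMap x).hom.toAlgebra
  let e : (Spec (.of L)).residueField (p x) ≃ₗ[(Spec (.of L)).residueField (p x)] X.residueField x :=
    LinearEquiv.ofBijective (Algebra.linearMap _ _)
      ⟨fun a b h ↦ (algebraMap _ (X.residueField x)).injective h, hsurj⟩
  change Module.finrank ((Spec (.of L)).residueField (p x)) (X.residueField x) = 1
  rw [← e.finrank_eq, Module.finrank_self]

end FieldPoint

namespace CurvePlaces

open RatFn FieldPoint CartierDivisor Literature.NumberTheory.DiophantineGeometry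
  Literature.NumberTheory.DiophantineGeometry.AlgFunctionField

/-! ### Rational points of a curve as sections -/

section Sections

variable {L : Type u} [Field L] (X : SchemeOver L) [IsIntegral X.left]
  [SmoothOfRelativeDimension 1 X.hom] [IsProper X.hom] [GeometricallyIntegral X.hom]

omit [IsIntegral X.left] [SmoothOfRelativeDimension 1 X.hom] [IsProper X.hom] [GeometricallyIntegral X.hom] in
/-- The rational points `X ×_L Spec L ∋ (s, id)` of distinct sections `s` are distinct. [folklore] -/
theorem ratPtPoint_id_injective :
    Function.Injective fun s : (Over.mk (𝟙 (Spec (.of L))) ⟶ X) ↦ ratPtPoint X (𝟙 _) s := by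
  intro s₁ s₂ h
  have h' : s₁.left (closedPoint L) = s₂.left (closedPoint L) := by
    rw [← fieldPointFst_ratPtPoint X (𝟙 _) s₁, ← fieldPointFst_ratPtPoint X (𝟙 _) s₂]
    exact congrArg _ h
  ext : 1
  exact section_ext X.hom (Over.w s₁) (Over.w s₂) h'

omit [IsIntegral X.left] in
/-- **The place of a rational point has degree one.** [folklore] -/
theorem degree_place_ratPtPoint (s : Over.mk (𝟙 (Spec (.of L))) ⟶ X) :
    (place (curveBC X (𝟙 _)) (ratPtPoint X (𝟙 _) s) (ratPtPoint_ne_genericPoint X _ s)).degree = 1 := by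
  rw [degree_place]
  exact residueDegree_eq_one_of_section (curveBC X (𝟙 _)).hom (ratPt_snd X (𝟙 _) s)

/-- **The general locus of a curve with `2g − 1` rational points is non-empty** (Milne,
Lemma 5.2 (b) with Prop. 4.2 (a)): among `N ≥ 2g − 1` distinct rational points there are `g` (with
repetitions) with `h⁰(Σ Pᵢ) = 1` (`exists_ell_sum_single_eq_one`), and the corresponding point of
`Cᵍ` is general (`imagePtPow_tuplePt_mem_generalLocus`). [cite: Milne1986JacobianVarieties, §5 Lemma 5.2 (b)] -/
theorem nonempty_generalLocus_of_sections {N : ℕ} (s : Fin N → (Over.mk (𝟙 (Spec (.of L))) ⟶ X))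
    (hs : Function.Injective s) (hN : 2 * curveGenus X ≤ N + 1) :
    (generalLocus X (curveGenus X)).Nonempty := by
  classical
  set X'' := curveBC X (𝟙 (Spec (.of L)))
  have hg : curveGenus X'' = curveGenus X := curveGenus_curveBC_id X
  let pl : Fin N → PlaceOver L X''.left.functionField := fun j ↦
    place X'' (ratPtPoint X (𝟙 _) (s j)) (ratPtPoint_ne_genericPoint X _ (s j))
  have hpl : Function.Injective pl := fun j₁ j₂ h ↦
    hs (ratPtPoint_id_injective X (place_injective (C := X'') _ _ h))
  set S : Finset (PlaceOver L X''.left.functionField) := Finset.univ.image pl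
  have hScard : S.card = N := by
    rw [Finset.card_image_of_injective _ hpl, Finset.card_univ, Fintype.card_fin]
  have hSdeg : ∀ v ∈ S, v.degree = 1 := by
    intro v hv
    obtain ⟨j, -, rfl⟩ := Finset.mem_image.1 hv
    exact degree_place_ratPtPoint X (s j)
  have hcard : 2 * genus L X''.left.functionField ≤ S.card + 1 := by
    rw [hScard]
    change 2 * curveGenus X'' ≤ N + 1
    rwa [hg]
  obtain ⟨v, hvS, hv⟩ := exists_ell_sum_single_eq_one (K := L) S hSdeg hcard
  -- indices `j i` with `v i = pl (j i)`
  have hj : ∀ i, ∃ j, pl j = v i := fun i ↦ by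
    obtain ⟨j, -, hj⟩ := Finset.mem_image.1 (hvS i)
    exact ⟨j, hj⟩
  choose j hj using hj
  have hmem := imagePtPow_tuplePt_mem_generalLocus X (𝟙 _) (fun i ↦ s (j i)) (by
    have : (fun i ↦ Finsupp.single (place (curveBC X (𝟙 _)) (ratPtPoint X (𝟙 _) (s (j i)))
        (ratPtPoint_ne_genericPoint X _ _)) (1 : ℤ)) = fun i ↦ Finsupp.single (v i) 1 := by
      funext i
      exact congrArg (Finsupp.single · (1 : ℤ)) (hj i)
    simp only [this]
    exact hv)
  rw [← hg]
  exact ⟨_, hmem⟩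

end Sections

/-! ### Over a finite Galois extension -/

section Galois

variable {K : Type u} [Field K] (C : SchemeOver K) [IsIntegral C.left]
  [SmoothOfRelativeDimension 1 C.hom] [IsProper C.hom] [GeometricallyIntegral C.hom]

/-- The structure morphism `Spec L → Spec K` of a `K`-algebra `L`. [folklore] -/
abbrev strPt (L : Type u) [Field L] [Algebra K L] : Spec (.of L) ⟶ Spec (.of K) :=
  Spec.map (CommRingCat.ofHom (algebraMap K L))

/-- The section of `C_L → Spec L` attached to an `L`-valued point of `C`. [folklore] -/
def sectionOfAlgPoint {L : Type u} [Field L] [Algebra K L] (Q : AlgPoints C L) :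
    Over.mk (𝟙 (Spec (.of L))) ⟶ curveBC C (strPt L) :=
  Over.homMk (ratPt C (strPt L) Q) (ratPt_snd C _ Q)

omit [IsIntegral C.left] [SmoothOfRelativeDimension 1 C.hom] [IsProper C.hom] [GeometricallyIntegral C.hom] in
/-- Distinct `L`-valued points give distinct sections. [folklore] -/
theorem sectionOfAlgPoint_injective {L : Type u} [Field L] [Algebra K L] :
    Function.Injective (sectionOfAlgPoint C (L := L)) := by
  intro Q₁ Q₂ h
  have h' : ratPt C (strPt L) Q₁ = ratPt C (strPt L) Q₂ := congrArg (fun s ↦ s.left) h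
  ext : 1
  rw [← ratPt_fst C (strPt L) Q₁, ← ratPt_fst C (strPt L) Q₂, h']

/-- **Over a suitable finite Galois extension `L / K` the general locus of `C_L` is non-empty and
`C` has an `L`-valued point** (Milne §4–§5 over `k_s`, in finite form: `exists_galois_algPoints_injective`,
`curveGenus_curveBC`, `nonempty_generalLocus_of_sections`). [cite: Milne1986JacobianVarieties, §4 Prop. 4.2 (a) and §5 Lemma 5.2 (b)] -/
theorem exists_galois_nonempty_generalLocus :
    ∃ (L : Type u) (_ : Field L) (_ : Algebra K L), FiniteDimensional K L ∧ IsGalois K L ∧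
      Nonempty (AlgPoints C L) ∧
      (generalLocus (curveBC C (strPt L)) (curveGenus (curveBC C (strPt L)))).Nonempty := by
  obtain ⟨L, _, _, hfin, hgal, Q, hQ⟩ := exists_galois_algPoints_injective C (2 * curveGenus C + 1)
  refine ⟨L, inferInstance, inferInstance, hfin, hgal, ⟨Q 0⟩, ?_⟩
  refine nonempty_generalLocus_of_sections (curveBC C (strPt L))
    (fun j ↦ sectionOfAlgPoint C (Q j)) ((sectionOfAlgPoint_injective C).comp hQ) ?_
  rw [curveGenus_curveBC]
  omega

end Galois

end CurvePlaces

end Literature.AlgebraicGeometry.Motives
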